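/-
Origin: expansion seat `planner-pub-hodgecm-qw8-g11-0`, handover #5 REPLACE (DOC-ONLY) md5 ed533b8e6a9bd183ca6307b331264409 (296 l.) SUPERSEDES tree `HodgeCM/Model/Toy/LefLefschetz.lean` ee41849b (288 l.): docstrings added to every undocumented theorem/def (CONVENTIONS §3 debt → 0), comment-stripped code IDENTICAL to the tree copy (residue md5 d02c59a0; no declaration, statement or proof changed); imports unchanged (HodgeCM.Model.Toy.LefTypes; NO rewrite); chec (`HOME/pub-hodgecm-qw8-g11/lean/Qw8g11/LefLefschetz.lean`, md5 ed533b8e, 296 lines);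
landed by the packager successor (mc-unitary-1-g3, gen-8 kit) in gate run 32 REPLACES the earlier landed copy of `HodgeCM/Model/Toy/LefLefschetz.lean` (seat copy carried the packager origin header of the earlier run (stripped)).
-/
-- HANDOVER (planner-pub-hodgecm-qw8-g6-0, unit pub-hodgecm-qw8-g6): WIP module `Qw8g6.LefLefschetz`; intended final module
-- `HodgeCM.Model.Toy.LefLefschetz` (kind L5, separating model); rename `import Qw8g6.X` ↦ `import HodgeCM.Model.Toy.X`.
/-
Copyright: pub-hodgecm cell (HodgeCMPerL). Separating-model layer (gen 5 of the [QW8] §2.5 lineage, seat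
pub-hodgecm-qw8-g5; gen-6 hygiene only). New file.
-/
import Summits.HodgeConjecture.HodgeCM.Model.Toy.LefTypes

/-!
# Rational `(1,1)`-classes have balanced Galois support (the Lefschetz content of `lefModel`)

For an object `X` of the toy category and a RATIONAL class `x ∈ ⋀²_ℚ L(X)` of Hodge type `(1,1)`
(`Θ(1 ⊗ x) ∈ F¹ ∩ \bar F¹ = FF 2 1 ⊓ GG 2 2`) we prove `Θ(1 ⊗ x) ∈ balSpan X 2`
(`Obj.theta_mem_balSpan_two`, `Obj.lefschetz11_bal`).  This is what makes `(1,1)`-classes "algebraic" in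
the cup-closed separating model `HodgeCM.Toy.lefModel` while genuine-face Weil classes are not.

Mechanism (no Hodge theory, only Galois theory of the coefficients): the coordinate of `Θ(1 ⊗ x)` along
the wedge-basis vector `e_a ∧ e_b` is the value at `Θ(1 ⊗ x)` of the functional
`D_{(a,b)} = det(e^{a}, e^{b})` (`Obj.D`), and on rational `x` these values are algebraic numbers moved
around by `Aut_ℚ(ℚ̄)`:  `γ · D_{(a,b)}(Θ(1⊗x)) = D_{(γa,γb)}(Θ(1⊗x))` (`Obj.D_theta_gact`).  A functional
`D_p` with `p` injective kills `FF k q` unless `q ≤ #hol(p)` and kills `GG k q` unless `#hol(p) < q`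
(`Obj.D_eq_zero_of_mem_FF/GG`).  Hence a non-zero coordinate at `{a,b}` forces, for EVERY `γ`, exactly one
of `γa, γb` to be holomorphic, i.e. `typ b = (typ a)ᶜ`: the pair is balanced.
-/

noncomputable section

set_option backward.isDefEq.respectTransparency false

open TensorProduct exteriorPower Module Literature.AlgebraicGeometry.Motives

namespace HodgeCM.Toy

namespace Obj

variable (X : Obj)

/-! ### Injectivity of the Galois action on indices -/

/-- `γ⁻¹ · (γ · s) = s` for the Galois action `gact` on the eigen-indices. -/
lemma gact_symm_gact (γ : Gam) (s : X.Idx) : X.gact γ.symm (X.gact γ s) = s := by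
  refine Sigma.ext rfl (heq_of_eq (RingHom.ext fun x => ?_))
  change ((γ.symm (X.liftE (X.gact γ s) x) : Qbar) : ℂ) = s.2 x
  rw [liftE_gact_apply, AlgEquiv.symm_apply_apply, coe_liftE]

/-- The Galois action `gact γ` on the eigen-indices is injective. -/
lemma gact_injective (γ : Gam) : Function.Injective (X.gact γ) :=
  Function.LeftInverse.injective (X.gact_symm_gact γ)

/-! ### The determinant functionals `D_p` -/

/-- `D_p (w₀ ∧ … ∧ w_{k-1}) = det (e^{p_j}(w_i))`, the functional built from the coordinate forms of the
eigenbasis at the indices `p_j` -/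
def D {k : ℕ} (p : Fin k → X.Idx) : Module.Dual ℂ (⋀[ℂ]^k X.LC) :=
  pairingDual ℂ X.LC k (ιMulti ℂ k fun j => X.eB.coord (p j))

/-- `D_p` on a pure wedge `w₀ ∧ … ∧ w_{k-1}` is the determinant `det (e^{p_j}(w_i))` of the
eigen-coordinates. -/
lemma D_ιMulti {k : ℕ} (p : Fin k → X.Idx) (w : Fin k → X.LC) :
    X.D p (ιMulti ℂ k w) = (Matrix.of fun i j => X.eB.repr (w i) (p j)).det := by
  rw [D, pairingDual_ιMulti_ιMulti]
  rfl

/-- the wedge-basis coordinates are values of `D` -/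
lemma basis_repr_eq_D {k : ℕ} (w : ⋀[ℂ]^k X.LC) (S : Set.powersetCard X.Idx k) :
    (X.eB.exteriorPower k).repr w S = X.D (fun i => (Set.powersetCard.ofFinEmbEquiv.symm S) i) w := by
  rw [exteriorPower.basis_repr_apply]
  rfl

/-- The wedge-basis vector indexed by `S` is the eigen-monomial `mono` of the (ordered) elements of
`S`. -/
lemma basis_eq_mono {k : ℕ} (S : Set.powersetCard X.Idx k) :
    (X.eB.exteriorPower k) S = X.mono k (fun i => (Set.powersetCard.ofFinEmbEquiv.symm S) i) := by
  rw [exteriorPower.basis_apply]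
  rfl

/-- Distinct eigenbasis vectors have zero cross-coordinates: `e^{t}(e_s) = 0` for `s ≠ t`. -/
lemma repr_eB_eB_eq_zero {s t : X.Idx} (h : s ≠ t) : X.eB.repr (X.eB s) t = 0 := by
  rw [Basis.repr_self, Finsupp.single_apply, if_neg h]

/-- **`D_p` kills `FF k q` when `#hol(p) < q`.** -/
theorem D_eq_zero_of_mem_FF {k : ℕ} {p : Fin k → X.Idx} (hp : Function.Injective p) {q : ℤ}
    (hq : (X.cnt p : ℤ) < q) {w : ⋀[ℂ]^k X.LC} (hw : w ∈ X.FF k q) : X.D p w = 0 := by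
  suffices h : X.FF k q ≤ LinearMap.ker (X.D p) from LinearMap.mem_ker.mp (h hw)
  rw [FF, Submodule.span_le]
  rintro _ ⟨g, hg, rfl⟩
  rw [SetLike.mem_coe, LinearMap.mem_ker]
  by_cases hginj : Function.Injective g
  · by_contra hne
    rw [mono_def, show X.eB ∘ g = fun j => X.eB (g j) from rfl, D_ιMulti] at hne
    have hcol : ∀ j, ∃ i, g i = p j := fun j => by
      by_contra h
      push Not at h
      exact hne (Matrix.det_eq_zero_of_column_eq_zero j fun i => by
        rw [Matrix.of_apply]; exact X.repr_eB_eB_eq_zero (h i))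
    have hrow : ∀ i, ∃ j, g i = p j := fun i => by
      by_contra h
      push Not at h
      exact hne (Matrix.det_eq_zero_of_row_eq_zero i fun j => by
        rw [Matrix.of_apply]; exact X.repr_eB_eB_eq_zero (h j))
    have himg : Finset.univ.image g = Finset.univ.image p := by
      ext s
      simp only [Finset.mem_image, Finset.mem_univ, true_and]
      constructor
      · rintro ⟨i, rfl⟩
        obtain ⟨j, hj⟩ := hrow i
        exact ⟨j, hj.symm⟩
      · rintro ⟨j, rfl⟩
        exact hcol j
    have h1 := X.nhol_image g hginj
    have h2 := X.nhol_image p hp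
    rw [himg, h2] at h1
    rw [← h1] at hg
    omega
  · rw [X.mono_eq_zero_of_not_injective hginj, map_zero]

/-- **`D_p` kills `GG k q` when `q ≤ #hol(p)`.** -/
theorem D_eq_zero_of_mem_GG {k : ℕ} {p : Fin k → X.Idx} (hp : Function.Injective p) {q : ℤ}
    (hq : q ≤ (X.cnt p : ℤ)) {w : ⋀[ℂ]^k X.LC} (hw : w ∈ X.GG k q) : X.D p w = 0 := by
  suffices h : X.GG k q ≤ LinearMap.ker (X.D p) from LinearMap.mem_ker.mp (h hw)
  rw [GG, Submodule.span_le]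
  rintro _ ⟨g, hg, rfl⟩
  rw [SetLike.mem_coe, LinearMap.mem_ker]
  by_cases hginj : Function.Injective g
  · by_contra hne
    rw [mono_def, show X.eB ∘ g = fun j => X.eB (g j) from rfl, D_ιMulti] at hne
    have hcol : ∀ j, ∃ i, g i = p j := fun j => by
      by_contra h
      push Not at h
      exact hne (Matrix.det_eq_zero_of_column_eq_zero j fun i => by
        rw [Matrix.of_apply]; exact X.repr_eB_eB_eq_zero (h i))
    have hrow : ∀ i, ∃ j, g i = p j := fun i => by
      by_contra h
      push Not at h
      exact hne (Matrix.det_eq_zero_of_row_eq_zero i fun j => by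
        rw [Matrix.of_apply]; exact X.repr_eB_eB_eq_zero (h j))
    have himg : Finset.univ.image g = Finset.univ.image p := by
      ext s
      simp only [Finset.mem_image, Finset.mem_univ, true_and]
      constructor
      · rintro ⟨i, rfl⟩
        obtain ⟨j, hj⟩ := hrow i
        exact ⟨j, hj.symm⟩
      · rintro ⟨j, rfl⟩
        exact hcol j
    have h1 := X.nhol_image g hginj
    have h2 := X.nhol_image p hp
    rw [himg, h2] at h1
    rw [← h1] at hg
    omega
  · rw [X.mono_eq_zero_of_not_injective hginj, map_zero]

/-! ### Galois equivariance of the values of `D_p` on rational classes -/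

/-- `D_p (Θ (1 ⊗ v₀ ∧ … ∧ v_{k-1})) = det( \widehat{p_j}(v_i) )`, an algebraic number -/
lemma D_theta_ιMulti {k : ℕ} (p : Fin k → X.Idx) (v : Fin k → X.L) :
    X.D p (X.Θ k ((1 : ℂ) ⊗ₜ[ℚ] ιMulti ℚ k v))
      = (((Matrix.of fun i j => X.liftE (p j) (v i (p j).1)).det : Qbar) : ℂ) := by
  have h1 : X.Θ k ((1 : ℂ) ⊗ₜ[ℚ] ιMulti ℚ k v) = ιMulti ℂ k fun i => (1 : ℂ) ⊗ₜ[ℚ] v i := by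
    change BC.theta ℚ ℂ X.L k ((1 : ℂ) ⊗ₜ[ℚ] ιMulti ℚ k v) = _
    rw [BC.theta_tmul_ιMulti, one_smul]
  rw [h1, D_ιMulti, show (((Matrix.of fun i j => X.liftE (p j) (v i (p j).1)).det : Qbar) : ℂ)
      = algebraMap Qbar ℂ (Matrix.of fun i j => X.liftE (p j) (v i (p j).1)).det from rfl,
    RingHom.map_det, RingHom.mapMatrix_apply]
  congr 1
  ext i j
  rw [Matrix.of_apply, Matrix.map_apply, Matrix.of_apply, repr_one_tmul]
  rfl

/-- … and its Galois conjugates are the values of the translated functionals -/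
lemma D_theta_ιMulti_gact {k : ℕ} (p : Fin k → X.Idx) (γ : Gam) (v : Fin k → X.L) :
    ((γ (Matrix.of fun i j => X.liftE (p j) (v i (p j).1)).det : Qbar) : ℂ)
      = X.D (fun j => X.gact γ (p j)) (X.Θ k ((1 : ℂ) ⊗ₜ[ℚ] ιMulti ℚ k v)) := by
  have hM : (γ : Qbar ≃ₐ[ℚ] Qbar).mapMatrix (Matrix.of fun i j => X.liftE (p j) (v i (p j).1))
      = Matrix.of fun i j => X.liftE (X.gact γ (p j)) (v i (p j).1) := by
    ext i j
    rw [AlgEquiv.mapMatrix_apply, Matrix.map_apply, Matrix.of_apply, Matrix.of_apply, liftE_gact_apply]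
  rw [D_theta_ιMulti, AlgEquiv.map_det, hM]
  rfl

/-- **Galois equivariance**: on a rational class, `γ · D_p = D_{γ p}` (values in `ℚ̄`). -/
theorem D_theta_gact {k : ℕ} (p : Fin k → X.Idx) (γ : Gam) (x : ⋀[ℚ]^k X.L) :
    ∃ z : Qbar, (z : ℂ) = X.D p (X.Θ k ((1 : ℂ) ⊗ₜ[ℚ] x)) ∧
      ((γ z : Qbar) : ℂ) = X.D (fun j => X.gact γ (p j)) (X.Θ k ((1 : ℂ) ⊗ₜ[ℚ] x)) := by
  have hx : x ∈ Submodule.span ℚ (Set.range (ιMulti ℚ k (M := X.L))) := by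
    rw [ιMulti_span]; trivial
  induction hx using Submodule.span_induction with
  | mem y hy =>
    obtain ⟨v, rfl⟩ := hy
    exact ⟨(Matrix.of fun i j => X.liftE (p j) (v i (p j).1)).det, (X.D_theta_ιMulti p v).symm,
      X.D_theta_ιMulti_gact p γ v⟩
  | zero =>
    refine ⟨0, ?_, ?_⟩
    · rw [tmul_zero, LinearEquiv.map_zero, LinearMap.map_zero]; rfl
    · rw [tmul_zero, LinearEquiv.map_zero, LinearMap.map_zero, map_zero]; rfl
  | add y y' _ _ hy hy' =>
    obtain ⟨z, hz, hγz⟩ := hy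
    obtain ⟨z', hz', hγz'⟩ := hy'
    refine ⟨z + z', ?_, ?_⟩
    · rw [tmul_add, LinearEquiv.map_add, LinearMap.map_add, ← hz, ← hz']; rfl
    · rw [tmul_add, LinearEquiv.map_add, LinearMap.map_add, ← hγz, ← hγz', map_add]; rfl
  | smul a y _ hy =>
    obtain ⟨z, hz, hγz⟩ := hy
    refine ⟨algebraMap ℚ Qbar a * z, ?_, ?_⟩
    · rw [tmul_smul, ← algebraMap_smul ℂ a, LinearEquiv.map_smul, LinearMap.map_smul, smul_eq_mul, ← hz]; rfl
    · rw [tmul_smul, ← algebraMap_smul ℂ a, LinearEquiv.map_smul, LinearMap.map_smul, smul_eq_mul, ← hγz,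
        map_mul, AlgEquiv.commutes]; rfl

/-! ### Two slots -/

/-- No subset of the Galois group `Gam` equals its own complement (test membership of `1`). -/
lemma set_ne_compl (A : Set Gam) : A ≠ Aᶜ := fun h => by
  have h1 : (1 : Gam) ∈ A ↔ (1 : Gam) ∈ Aᶜ := by rw [← h]
  rw [Set.mem_compl_iff] at h1
  exact iff_not_self h1

/-- a pair with complementary types is balanced -/
lemma bal_of_typ_compl {g : Fin 2 → X.Idx} (h : X.typ (g 1) = (X.typ (g 0))ᶜ) : X.Bal g := by
  intro T
  classical
  rw [tcnt_eq_card_filter, tcnt_eq_card_filter, Finset.card_filter, Finset.card_filter,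
    Fin.sum_univ_two, Fin.sum_univ_two, h]
  by_cases h0 : X.typ (g 0) = T
  · subst h0
    have h1 : ¬ (X.typ (g 0))ᶜ = X.typ (g 0) := fun e => set_ne_compl _ e.symm
    have h2 : ¬ X.typ (g 0) = (X.typ (g 0))ᶜ := set_ne_compl _
    simp [h1, h2]
  · by_cases h1 : (X.typ (g 0))ᶜ = T
    · subst h1
      simp [h0, compl_compl]
    · have h0' : ¬ X.typ (g 0) = Tᶜ := fun e => h1 (by rw [e, compl_compl])
      have h1' : ¬ (X.typ (g 0))ᶜ = Tᶜ := fun e => h0 (compl_injective e)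
      simp [h0, h1, h0', h1']

/-- if every Galois translate of the pair `g` has exactly one holomorphic slot, `g` is balanced -/
lemma bal_two_of_cnt {g : Fin 2 → X.Idx} (h : ∀ γ : Gam, X.cnt (fun i => X.gact γ (g i)) = 1) : X.Bal g := by
  apply bal_of_typ_compl
  ext γ
  rw [mem_typ, Set.mem_compl_iff, mem_typ]
  have h1 := h γ
  classical
  rw [cnt_eq_card_filter, Finset.card_filter, Fin.sum_univ_two] at h1
  by_cases ha : X.hol (X.gact γ (g 0)) <;> by_cases hb : X.hol (X.gact γ (g 1)) <;> simp_all

/-! ### The theorem -/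

/-- **Rational `(1,1)`-classes have balanced support.** -/
theorem theta_mem_balSpan_two (x : ⋀[ℚ]^2 X.L) (hF : X.Θ 2 ((1 : ℂ) ⊗ₜ[ℚ] x) ∈ X.FF 2 1)
    (hG : X.Θ 2 ((1 : ℂ) ⊗ₜ[ℚ] x) ∈ X.GG 2 2) : X.Θ 2 ((1 : ℂ) ⊗ₜ[ℚ] x) ∈ X.balSpan 2 := by
  rw [← (X.eB.exteriorPower 2).sum_repr (X.Θ 2 ((1 : ℂ) ⊗ₜ[ℚ] x))]
  refine Submodule.sum_mem _ fun S _ => ?_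
  by_cases hc : (X.eB.exteriorPower 2).repr (X.Θ 2 ((1 : ℂ) ⊗ₜ[ℚ] x)) S = 0
  · rw [hc, zero_smul]
    exact zero_mem _
  refine Submodule.smul_mem _ _ ?_
  rw [basis_eq_mono]
  apply X.mono_mem_balSpan
  rw [basis_repr_eq_D] at hc
  have heinj : Function.Injective (fun i => (Set.powersetCard.ofFinEmbEquiv.symm S) i) :=
    (Set.powersetCard.ofFinEmbEquiv.symm S).injective
  apply X.bal_two_of_cnt
  intro γ
  obtain ⟨z, hz, hγz⟩ := X.D_theta_gact (fun i => (Set.powersetCard.ofFinEmbEquiv.symm S) i) γ x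
  have hz0 : z ≠ 0 := fun h0 => hc (by rw [← hz, h0, ZeroMemClass.coe_zero])
  have hγz0 : γ z ≠ 0 := (EmbeddingLike.map_ne_zero_iff).mpr hz0
  have hne : X.D (fun i => X.gact γ ((Set.powersetCard.ofFinEmbEquiv.symm S) i)) (X.Θ 2 ((1 : ℂ) ⊗ₜ[ℚ] x)) ≠ 0 := by
    rw [← hγz]
    exact fun h => hγz0 (ZeroMemClass.coe_eq_zero.mp h)
  have hinjγ : Function.Injective (fun i => X.gact γ ((Set.powersetCard.ofFinEmbEquiv.symm S) i)) :=
    (X.gact_injective γ).comp heinj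
  have h1 : ¬ ((X.cnt (fun i => X.gact γ ((Set.powersetCard.ofFinEmbEquiv.symm S) i)) : ℤ) < 1) :=
    fun hlt => hne (X.D_eq_zero_of_mem_FF hinjγ hlt hF)
  have h2 : ¬ ((2 : ℤ) ≤ X.cnt (fun i => X.gact γ ((Set.powersetCard.ofFinEmbEquiv.symm S) i))) :=
    fun hle => hne (X.D_eq_zero_of_mem_GG hinjγ hle hG)
  omega

/-- **Lefschetz `(1,1)` for the balanced model**: a rational Hodge class of degree `2` has balanced support. -/
theorem lefschetz11_bal (x : ⋀[ℚ]^2 X.L) (hx : x ∈ (X.hodgeStructure 2).hodgeClasses 1) :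
    X.Θ 2 ((1 : ℂ) ⊗ₜ[ℚ] x) ∈ X.balSpan 2 := by
  have hp := HodgeStructure.ofRat_mem_piece_of_mem_hodgeClasses (X.hodgeStructure 2) (p := 1) (by norm_num) hx
  rw [HodgeStructure.piece_of_add_eq _ (by norm_num), Submodule.mem_inf] at hp
  obtain ⟨hF, hG⟩ := hp
  have hG' : HodgeStructure.ofRat x ∈ (X.GG 2 2).comap (X.Θ 2).toLinearMap := by
    rw [← X.complexConj_hodgeF 2 2 1 (by norm_num)]
    exact hG
  exact X.theta_mem_balSpan_two x hF hG'

end Obj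

end HodgeCM.Toy

end
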